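import Summits.ABC.ABC.Theses.FeketeScales
import Summits.ABC.ABC.Theorems.FeketeScalesPolynomialAbcOfSubmult
import Summits.ABC.ABC.Theorems.FeketeScalesSubmultOfRST
import Literature.NumberTheory.DiophantineGeometry.AbcWave0SUnitProofs

/-!
# Sketch — crux-ideate stmt-ABC-2160 (ScaleSubmultiplicativity), round 1, ideator 1

First lemmas of the idea card `power-shape-cyclotomic-descent` and the Lean forms of the
hardness certificates recorded in the crux NOTES (planner-cruxidea-stmt-ABC-2160-1-0, 2026-08-16).
Statements over existing declarations only; `sorry` where a statement is offered, not proved.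
-/

open Literature.NumberTheory.DiophantineGeometry

namespace Summit.ABC.ABC.Cruxes.ScaleSubmultiplicativity.Ideator1

open Summit.ABC.ABC.Theses.FeketeScales

/-- FIRST LEMMA (card power-shape-cyclotomic-descent), the exact descent identity for
`n`-power-shaped triples `(x^n, z^n - x^n, z^n)`: the sub-triple `T'' = (x, z - x, z)` and the
cyclotomic cofactor `Φ = (z^n - x^n)/(z - x)` satisfy `rad(T'')·rad(Φ) ≤ n·rad(T)` (because
`gcd(z - x, Φ) ∣ n`), `z^n ≤ z·Φ` and `Φ ≤ n·z^(n-1)`.  Elementary; offered, not yet proved. -/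
theorem powerShape_descent (n x z : ℕ) (hn : 2 ≤ n) (hx : 0 < x) (hxz : x < z)
    (hcop : Nat.Coprime x z) :
    IsABCTriple (x ^ n) (z ^ n - x ^ n) (z ^ n) ∧ IsABCTriple x (z - x) z ∧
      rad x (z - x) z * UniqueFactorizationMonoid.radical ((z ^ n - x ^ n) / (z - x))
        ≤ n * rad (x ^ n) (z ^ n - x ^ n) (z ^ n) ∧
      z ^ n ≤ z * ((z ^ n - x ^ n) / (z - x)) ∧
      (z ^ n - x ^ n) / (z - x) ≤ n * z ^ (n - 1) := by
  sorry

/-- The RESIDUAL of the descent: powerful excess of cyclotomic cofactors is sub-power in the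
height.  `Φ/rad Φ ≤ K·exp((log z^n)^θ)` for some `θ < 1`, uniformly in `n ≥ 2`, `x < z` coprime.
(Pointwise, abc-type, open; contains "the powerful part of `2^n - 1` is `2^{o(n)}`".) -/
def CyclotomicPowerfulSubpower : Prop :=
  ∃ θ : ℝ, θ < 1 ∧ ∃ K : ℝ, 0 < K ∧ ∀ n x z : ℕ, 2 ≤ n → 0 < x → x < z → Nat.Coprime x z →
    (((z ^ n - x ^ n) / (z - x) : ℕ) : ℝ) ≤
      K * Real.exp (Real.log ((z : ℝ) ^ n) ^ θ) *
        (UniqueFactorizationMonoid.radical ((z ^ n - x ^ n) / (z - x)) : ℕ)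

/-- What the descent buys: on power-shaped triples the crux inequality holds AT THE NATURAL
SPLITTING `R₁ = rad(T'')`, `R₂ = n·rad(Φ)` with the sub-triple itself and `(1, 2^j - 1, 2^j)` as
witnesses, granted `CyclotomicPowerfulSubpower`.  (Offered; the crux quantifies over ALL splittings
and ALL triples — this covers neither, see the card's coverage statement.) -/
theorem crux_at_natural_splitting_of_powerShape (h : CyclotomicPowerfulSubpower) :
    ∃ θ : ℝ, θ < 1 ∧ ∃ K : ℝ, 0 < K ∧ ∀ n x z : ℕ, 2 ≤ n → 0 < x → x < z → Nat.Coprime x z →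
      8 ≤ UniqueFactorizationMonoid.radical ((z ^ n - x ^ n) / (z - x)) →
      ∃ a₂ b₂ c₂ : ℕ, IsABCTriple a₂ b₂ c₂ ∧
        rad a₂ b₂ c₂ ≤ UniqueFactorizationMonoid.radical ((z ^ n - x ^ n) / (z - x)) ∧
        ((z ^ n : ℕ) : ℝ) ≤ K * Real.exp (Real.log ((rad x (z - x) z : ℝ) *
            (n * UniqueFactorizationMonoid.radical ((z ^ n - x ^ n) / (z - x)) : ℕ)) ^ θ) * z * c₂ := by
  sorry

/-! ### Hardness certificates (crux NOTES, `## Barrier notes`) -/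

/-- Certificate 1 (PROVED, from the crux ALONE, via the tree's proved support
`polynomialAbcOfSubmult_proof` and the discharged abc.S25
`finite_setOf_isABCTriple_primeFactors_subset_holds`): any proof of the crux gives an EXPONENTIAL
lower bound for the radical of Mersenne numbers, `2^m ≤ C·rad(1·(2^m-1)·2^m)^A` — open; the proved
state of the art is polynomial in `m` (Stewart–Yu), cf. crux `PrimePowerRadical` of route
IneffectiveSubspace. -/
theorem mersenneRadical_of_crux (hS : ScaleSubmultiplicativity) :
    ∃ A C : ℝ, ∀ m : ℕ, 1 ≤ m → ((2 ^ m : ℕ) : ℝ) ≤ C * ((rad 1 (2 ^ m - 1) (2 ^ m) : ℕ) : ℝ) ^ A := by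
  obtain ⟨A, C, hAC⟩ := Summit.ABC.ABC.Theorems.polynomialAbcOfSubmult_proof hS
    finite_setOf_isABCTriple_primeFactors_subset_holds
  refine ⟨A, C, fun m hm => ?_⟩
  have h2 : 2 ≤ 2 ^ m := by
    calc (2:ℕ) = 2 ^ 1 := by norm_num
      _ ≤ 2 ^ m := Nat.pow_le_pow_right (by norm_num) hm
  have ht : IsABCTriple 1 (2 ^ m - 1) (2 ^ m) :=
    ⟨Nat.one_pos, by omega, by omega, Nat.coprime_one_left _⟩
  exact_mod_cast hAC 1 (2 ^ m - 1) (2 ^ m) ht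

/-- Certificate 1' (PROVED): the pointwise sub-power bound — hypothesis of the route's support
`SubmultOfRST`, proved there to IMPLY the crux — is the only known sufficient condition; recorded
here as the composition `SubPower → crux` by name. -/
theorem crux_of_subPower
    (hP : ∃ τ : ℝ, τ < 1 ∧ ∃ A : ℝ, ∀ a b c : ℕ, IsABCTriple a b c →
      (c : ℝ) < ((rad a b c : ℕ) : ℝ) * Real.exp (A * Real.log ((rad a b c : ℕ) : ℝ) ^ τ)) :
    ScaleSubmultiplicativity :=
  Summit.ABC.ABC.Theorems.submultOfRST_proof hP

/-- Certificate 2 (statement only): the ONLY known sufficient condition for the crux, the pointwise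
sub-power excess `P_τ` (= hypothesis of `SubmultOfRST`), implies ROTH'S THEOREM WITH SUB-POWER
SAVINGS for every real algebraic number (Elkies–Langevin Belyi transfer, Bombieri–Gubler
Thm 12.2.9 / Rem 12.2.10 / Thm 12.2.12 with the error term carried along): unknown for every
`τ < 1` and every algebraic number of degree `≥ 3` (Roth: `q^{-2-ε}`, ineffective). -/
def RothWithSubpowerSavings (τ : ℝ) : Prop :=
  ∀ α : ℝ, IsAlgebraic ℚ α → Irrational α → ∃ C : ℝ, 0 < C ∧ ∀ p : ℤ, ∀ q : ℕ, 2 ≤ q →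
    Real.exp (-(C * Real.log q ^ τ)) / (C * (q : ℝ) ^ 2) ≤ |α - p / q|

theorem roth_savings_of_subpower (τ : ℝ) (hτ : τ < 1)
    (hP : ∃ A : ℝ, ∀ a b c : ℕ, IsABCTriple a b c →
      (c : ℝ) < (rad a b c : ℝ) * Real.exp (A * Real.log (rad a b c : ℕ) ^ τ)) :
    RothWithSubpowerSavings (max τ 0) := by
  sorry

end Summit.ABC.ABC.Cruxes.ScaleSubmultiplicativity.Ideator1
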